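/-
Origin: expansion seat `planner-pub-hodgecm-mc-sanity-1-g7-0`, handover #2 2026-08-19T13:00Z md5 c263b2a1521d (NEW additive KERNEL leaf, node SAN-17a: 101 l., 8 theorems in ns HodgeCM.Model.Sanity — isLFAction_degThetaAdelicSide / isThetaArchContinuous_degThetaAdelicSide (any Φ_∞, x₀, hx₀), isLFAction_degThetaAdelicSide₀ / isThetaArchContinuous_degThetaAdelicSide₀, isLFAction_degS / isThetaArchContinuous_degS (moved here verbatim from SAN-17 rev. 1), hLF_degS / hT_degS (E's literal binder shapes `∀ {L ι₁} V c k[, N], ((degS V c).P k).IsLFAction / .IsThetaArchContinuous N` as closed terms); proofs `fun _ => isLFContinuous_id.congr fun _ => rfl` + theta-3-g4 `WeilPairData.isThetaArchContinuous_of_isLFContinuous` (ThetaHolContinuity :100); LIGHT imports ON PURPOSE = HodgeCM.Model.Sanity.ThetaAdelicSideDegenerate (RUN-35 M3 ″ 48a1ca2e3628) + HodgeCM.Model.ThetaHolContinuity (RUN-35 #4) only, NO E file — the supply point for hT/hLF at the dif-fallback degenerate branch of an honest S-term (model1-g6 (S-restr) note (i) 12:54:54Z); INSTALL AFTER both imports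 (RUN-35 world); compiled against p-g11's RUN-35 IN-PLACE oleans via a private symlink overlay (next2/.olean, 615 symlinks + 2 own oleans, no PKG write): rc 0 / 0 warnings in 15 s (build/san17a-try3.log), #print axioms 8/8 ⊆ {propext, Classical.choice, Quot.sound} (build/ax-san17rev2.out); `set_option autoImplicit false`, `open scoped SchwartzMap Classical` (as M3), no proof-hole, nothing cited, 0 records / 0 Prop defs / MODEL-N ±0; INSTALL AS IS) (`HOME/mc/pub-hodgecm-mc-sanity-1-g7/next2/HodgeCM/Model/Sanity/ThetaAdelicSideDegenerateLF.lean`, md5 c263b2a1, 101 lines);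
landed by the gen-12 packager (p-g12) in gate run 36 as `HodgeCM/Model/Sanity/ThetaAdelicSideDegenerateLF.lean` (verbatim).
-/
/-
Origin: SANITY lane `planner-pub-hodgecm-mc-sanity-1-g7-0` (unit pub-hodgecm-mc-sanity-1-g7, gen 7 of mc-sanity-1,
node SAN-17a), 2026-08-19.  NEW additive KERNEL leaf `HodgeCM/Model/Sanity/ThetaAdelicSideDegenerateLF.lean` over the
RUN-35 modules `HodgeCM.Model.Sanity.ThetaAdelicSideDegenerate` (v2 packet M3 ″) and `HodgeCM.Model.ThetaHolContinuity`
(theta-3-g4 #4).  LIGHT imports (no E file) on purpose: this is the supply point for E's binders `hT` / `hLF` at the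
degenerate side — in particular at the `dif`-fallback branch `degThetaAdelicSide₀` / `degS` of an honest `S`-term
(model1-g6, (S-restr) content note (i), STATUS 2026-08-19T12:54:54Z).  Imported by `Sanity/DegenerateClosureR17A`
(SAN-17 rev. 2), importable by `Model/ArchSideTerm` (period-1, RUN 37) or any other `S`-consumer without `hV`.
KERNEL: 0 records, 0 `Prop` definitions, 0 hypotheses minted, nothing cited, no instances.
Expected `#print axioms`: ⊆ {propext, Classical.choice, Quot.sound}.
-/
import Summits.HodgeConjecture.HodgeCM.Model.Sanity.ThetaAdelicSideDegenerate
import Summits.HodgeConjecture.HodgeCM.Model.ThetaHolContinuity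

/-!
# SAN-17a — `hLF` and `hT` are FREE over the degenerate adelic theta side

MODEL-CONSTRUCTION sub-cell, SANITY lane (unit `pub-hodgecm-mc-sanity-1-g7`, node SAN-17a).  KERNEL only.

E's binders of R15A″ / R17A″ about the DATA `S : ∀ V c, ThetaAdelicSide V c` that carry NO `hV` / `GoodCtx`
(E2InstanceR15A :131ff, BINDER-TRIAGE §41.3) —
`hT : ∀ V c (k : Fin 4) (N : ℕ), ((S V c).P k).IsThetaArchContinuous N` and
`hLF : ∀ V c (k : Fin 4), ((S V c).P k).IsLFAction` — must hold OFF the anisotropic regime as well, i.e. on whatever an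
honest `S`-term returns there; the PKG's degenerate inhabitant is `degThetaAdelicSide V c Φ_∞ x₀ hx₀` (all four pair data
`trivialPairDataAt …`, action `ω := 1`), with the parameter-free instances `degThetaAdelicSide₀ V c` and `degS`.
Over these the two binders cost nothing:

* `isLFAction_degThetaAdelicSide` / `isLFAction_degThetaAdelicSide₀` / `isLFAction_degS` — every `ω(g)` is
  `1 = id` of `𝒮(𝔸_f^3)`-valued test functions, LF-continuous by `isLFContinuous_id`;
* `isThetaArchContinuous_degThetaAdelicSide` / `…₀` / `isThetaArchContinuous_degS` — hence (H1) by theta-3-g4's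
  `WeilPairData.isThetaArchContinuous_of_isLFContinuous` (`Model/ThetaHolContinuity` :100);
* `hLF_degS` / `hT_degS` — the two binders in E's literal quantifier shape, as closed terms.

READING (census, MODEL-N ±0): a consumer whose `S`-term falls back to the degenerate side by `dif_neg` discharges `hT` /
`hLF` on that branch by these lemmas (after `rw [dif_neg h]` or `split`); on the honest branch they remain the producer's
(W-cont)/(H1) content.  Nothing here is a defect claim.
-/

set_option autoImplicit false

noncomputable section

namespace HodgeCM
namespace Model
namespace Sanity

open NumberField NumberField.mixedEmbedding
open Literature.NumberTheory.Automorphic Literature.NumberTheory.Weil1964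
open Literature.AlgebraicGeometry.ShimuraVarieties
open HodgeCM.PerL34.SupplyAdelic HodgeCM.Model.SupplyInstance HodgeCM.Model.SupplyResidual
open scoped SchwartzMap Classical

variable {L : CMField} {ι₁ : L →+* ℂ} (V : HermSpace3 L ι₁) (c : SeesawCtx L)

/-- **`hLF` is free over the degenerate side** (any archimedean parameter `Φ_∞`, `x₀`): the pair action is `ω := 1`,
so every `ω(g)` is the identity, LF-continuous by `isLFContinuous_id`. -/
theorem isLFAction_degThetaAdelicSide (Φinf : 𝓢((Fin 3 → mixedSpace (maximalRealSubfield L)), ℂ))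
    (x₀ : Fin 3 → maximalRealSubfield L) (hx₀ : Φinf (archEmb (maximalRealSubfield L) (Fin 3) x₀) ≠ 0) (k : Fin 4) :
    ((degThetaAdelicSide V c Φinf x₀ hx₀).P k).IsLFAction :=
  fun _ => isLFContinuous_id.congr fun _ => rfl

/-- **`hT` is free over the degenerate side**: (H1) from `isLFAction_degThetaAdelicSide` by
`WeilPairData.isThetaArchContinuous_of_isLFContinuous`. -/
theorem isThetaArchContinuous_degThetaAdelicSide (Φinf : 𝓢((Fin 3 → mixedSpace (maximalRealSubfield L)), ℂ))
    (x₀ : Fin 3 → maximalRealSubfield L) (hx₀ : Φinf (archEmb (maximalRealSubfield L) (Fin 3) x₀) ≠ 0) (k : Fin 4)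
    (N : ℕ) : ((degThetaAdelicSide V c Φinf x₀ hx₀).P k).IsThetaArchContinuous N :=
  ((degThetaAdelicSide V c Φinf x₀ hx₀).P k).isThetaArchContinuous_of_isLFContinuous
    (isLFAction_degThetaAdelicSide V c Φinf x₀ hx₀ k) N

/-- `hLF` over the parameter-free degenerate side `degThetaAdelicSide₀` (the natural `dif`-fallback term). -/
theorem isLFAction_degThetaAdelicSide₀ (k : Fin 4) : ((degThetaAdelicSide₀ V c).P k).IsLFAction :=
  fun _ => isLFContinuous_id.congr fun _ => rfl

/-- `hT` over `degThetaAdelicSide₀`. -/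
theorem isThetaArchContinuous_degThetaAdelicSide₀ (k : Fin 4) (N : ℕ) :
    ((degThetaAdelicSide₀ V c).P k).IsThetaArchContinuous N :=
  ((degThetaAdelicSide₀ V c).P k).isThetaArchContinuous_of_isLFContinuous (isLFAction_degThetaAdelicSide₀ V c k) N

/-- **`hLF` is free over `degS`** (E's literal `S`-shape, inhabited degenerately; SAN-16's note, now kernel). -/
theorem isLFAction_degS (k : Fin 4) : ((degS V c).P k).IsLFAction :=
  fun _ => isLFContinuous_id.congr fun _ => rfl

/-- **`hT` is free over `degS`** (R15A's (H1) binder). -/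
theorem isThetaArchContinuous_degS (k : Fin 4) (N : ℕ) : ((degS V c).P k).IsThetaArchContinuous N :=
  ((degS V c).P k).isThetaArchContinuous_of_isLFContinuous (isLFAction_degS V c k) N

/-- E-R17A's binder `hLF` in its literal quantifier shape, at `S := degS`. -/
theorem hLF_degS : ∀ {L : CMField} {ι₁ : L →+* ℂ} (V : HermSpace3 L ι₁) (c : SeesawCtx L) (k : Fin 4),
    ((degS V c).P k).IsLFAction :=
  fun V c k => isLFAction_degS V c k

/-- E-R15A's binder `hT` in its literal quantifier shape, at `S := degS`. -/
theorem hT_degS : ∀ {L : CMField} {ι₁ : L →+* ℂ} (V : HermSpace3 L ι₁) (c : SeesawCtx L) (k : Fin 4) (N : ℕ),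
    ((degS V c).P k).IsThetaArchContinuous N :=
  fun V c k N => isThetaArchContinuous_degS V c k N

end Sanity
end Model
end HodgeCM

end
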